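import Mathlib
import Literature.Barriers.PneNP.ExtendedFormulationLinearImage
import Literature.Barriers.PneNP.CorrelationPolytopeXCLowerBoundGraph
import Summits.ValiantsHypothesis.ValiantsHypothesis.Theorems.FifoMatchingNNDivisionHardExactIsVirtual
import Summits.ValiantsHypothesis.ValiantsHypothesis.Theorems.FifoMatchingNNDivisionHardLocalization
import HarnessLib

/-!
# THE EXACT LOCATED LAW IS COR-VIRTUAL — part 2 of 2: the line's GRAPH currency (`LocatedRows.CorVirtualHardN ↔ Localization.CorVirtualHard`,
`LocatedRows.ExactPencilLaw ↔ Localization.CorVirtualHard`; crux `NNDivisionHard`, stmt-ValiantsHypothesis-21181)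

(PART 2 of 2 of the Theorems port of `Cruxes/NNDivisionHard/ExactIsVirtual41.lean` rev 2 @56f151ef35e4, §5 verbatim by name; press as
`Theorems/FifoMatchingNNDivisionHardExactIsVirtualGraph.lean`, `--kind proof --supports stmt-ValiantsHypothesis-21181 --as helper`, after part 1.)

Per the critic's port note V#104a (α) the graph-currency statement is NOT re-declared: it is the LANDED
`…Theorems.FifoMatching.Localization.CorVirtualHard` (`Theorems/FifoMatchingNNDivisionHardLocalization.lean` l. 46 — verbatim the line's
`VPLine.CorVirtualHard`, `Cruxes/NNDivisionHard/Lines/virtual_passenger.lean` l. 111, binder for binder; its `Localization.T` is δ-equal to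
`LocatedRows.T`), and the workfile's graph-currency theorems are stated here against it by name:
`corVirtualHard_of_corVirtualHardN` is the line's l. 312 transport verbatim and `corVirtualHardN_of_corVirtualHard` its `e.symm` twin
(pull the flat passenger back along `LinearEquiv.funCongrLeft ℝ ℝ finProdFinEquiv.symm`; `corPolytope_eq_image_corPolytopeGraph_top`,
`HasEFOfSize.image_linearEquiv_iff`).  With the pen's `coreLawOrb_iff_corVirtualHard : CoreLawOrb ↔ CorVirtualHard` (kernel, in the
line, rev 21/22) this makes C′ = `ExactPencilLaw` ⟺ the registered research stub `stub_coreLaw`, up to δ-equal restatement: a kernel `¬ExactPencilLaw`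
would refute the stub (line `virtual_passenger` dead), not "fall the line back to `CoreLawOrb`".

HONEST LABEL: REFORMULATION / transport only; `CorVirtualHardN`, `Localization.CorVirtualHard`, `ExactPencilLaw`, 21181 OPEN; VP ≠ VNP is NOT proved.
-/

set_option autoImplicit false

-- the mandated summit-side namespace repeats a component by design (single-problem summit)
set_option linter.dupNamespace false

noncomputable section

open Matrix Finset
open scoped Pointwise

namespace Summit.ValiantsHypothesis.ValiantsHypothesis.Theorems.FifoMatching.ExactIsVirtual

open Literature.Barriers.PneNP (HasEFOfSize)
open Literature.Combinatorics.Optimization.FixedSizePsdRank (corPolytope)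
open Literature.Combinatorics.Optimization (corPolytopeGraph)
open Summit.ValiantsHypothesis.ValiantsHypothesis.Theorems.FifoMatching.LocatedRows (CorVirtualHardN ExactPencilLaw)
open Summit.ValiantsHypothesis.ValiantsHypothesis.Theorems.FifoMatching.Localization (CorVirtualHard)

/-! ## §5 The graph currency: `LocatedRows.CorVirtualHardN ↔ Localization.CorVirtualHard` (so, with the line's
`coreLawOrb_iff_corVirtualHard`, `ExactPencilLaw ↔ stub_coreLaw` up to δ-equal restatement) -/

/-- flat ⇒ graph (verbatim the line's `corVirtualHard_of_corVirtualHardN`, val-idea-39 g3 P-P1a; the final `exact` crosses the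
δ-equal thresholds `LocatedRows.T` / `Localization.T` by `rfl`). -/
theorem corVirtualHard_of_corVirtualHardN (hN : CorVirtualHardN) : CorVirtualHard := by
  intro c
  obtain ⟨h₀, hh₀⟩ := hN c
  refine ⟨h₀, fun h hh K q r hQ hR => ?_⟩
  let e : (Fin h × Fin h → ℝ) ≃ₗ[ℝ] (Fin (h * h) → ℝ) :=
    LinearEquiv.funCongrLeft ℝ ℝ (finProdFinEquiv (m := h) (n := h)).symm
  have hQimg : e '' convexHull ℝ (Set.range q) = convexHull ℝ (Set.range (e ∘ q)) := by
    rw [Set.range_comp]; exact e.toLinearMap.image_convexHull (Set.range q)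
  have himg : e '' (corPolytopeGraph (⊤ : SimpleGraph (Fin h)) + convexHull ℝ (Set.range q)) =
      corPolytope h + convexHull ℝ (Set.range (e ∘ q)) := by
    rw [Set.image_add, Literature.Barriers.PneNP.corPolytope_eq_image_corPolytopeGraph_top, hQimg]
  have hR' : HasEFOfSize (corPolytope h + convexHull ℝ (Set.range (e ∘ q))) r := by
    rw [← himg]; exact (Literature.Barriers.PneNP.HasEFOfSize.image_linearEquiv_iff e).2 hR
  have hQ' : HasEFOfSize (convexHull ℝ (Set.range (e ∘ q))) r := by
    rw [← hQimg]; exact (Literature.Barriers.PneNP.HasEFOfSize.image_linearEquiv_iff e).2 hQ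
  exact hh₀ h hh K (e ∘ q) r hR' hQ'

/-- ★ graph ⇒ flat (the direction the tree lacked): pull the flat passenger back along the same linear equivalence. -/
theorem corVirtualHardN_of_corVirtualHard (hG : CorVirtualHard) : CorVirtualHardN := by
  intro c
  obtain ⟨h₀, hh₀⟩ := hG c
  refine ⟨h₀, fun n hn K q' r hR' hQ' => ?_⟩
  let e : (Fin n × Fin n → ℝ) ≃ₗ[ℝ] (Fin (n * n) → ℝ) :=
    LinearEquiv.funCongrLeft ℝ ℝ (finProdFinEquiv (m := n) (n := n)).symm
  let q : Fin (K + 1) → (Fin n × Fin n → ℝ) := fun j => e.symm (q' j)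
  have heq : e ∘ q = q' := funext fun j => e.apply_symm_apply (q' j)
  have hQimg : e '' convexHull ℝ (Set.range q) = convexHull ℝ (Set.range q') := by
    rw [← heq, Set.range_comp]; exact e.toLinearMap.image_convexHull (Set.range q)
  have himg : e '' (corPolytopeGraph (⊤ : SimpleGraph (Fin n)) + convexHull ℝ (Set.range q)) =
      corPolytope n + convexHull ℝ (Set.range q') := by
    rw [Set.image_add, Literature.Barriers.PneNP.corPolytope_eq_image_corPolytopeGraph_top, hQimg]
  have hR : HasEFOfSize (corPolytopeGraph (⊤ : SimpleGraph (Fin n)) + convexHull ℝ (Set.range q)) r := by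
    rw [← Literature.Barriers.PneNP.HasEFOfSize.image_linearEquiv_iff e, himg]; exact hR'
  have hQ : HasEFOfSize (convexHull ℝ (Set.range q)) r := by
    rw [← Literature.Barriers.PneNP.HasEFOfSize.image_linearEquiv_iff e, hQimg]; exact hQ'
  exact hh₀ n hn K q r hQ hR

/-- ★★ the two currencies agree. -/
theorem corVirtualHardN_iff_corVirtualHard : CorVirtualHardN ↔ CorVirtualHard :=
  ⟨corVirtualHard_of_corVirtualHardN, corVirtualHardN_of_corVirtualHard⟩

/-- ★★★ C′ in the line's own currency: `LocatedRows.ExactPencilLaw ↔ Localization.CorVirtualHard` (compose with the pen's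
`coreLawOrb_iff_corVirtualHard : CoreLawOrb ↔ VPLine.CorVirtualHard`, δ-equal statement: C′ ⟺ the registered research stub). -/
theorem exactPencilLaw_iff_corVirtualHard : ExactPencilLaw ↔ CorVirtualHard :=
  exactPencilLaw_iff_corVirtualHardN.trans corVirtualHardN_iff_corVirtualHard



end Summit.ValiantsHypothesis.ValiantsHypothesis.Theorems.FifoMatching.ExactIsVirtual

end
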